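import Summits.AtomisticToContinuum.Crystallization.Theorems.FrustratedLawDichotomyStrainedPatchHomEntryLeafHTKit

/-!
# `entryLeafOKHT`: the ANALYTIC-SLAB ξ-BOX LEAF (certificate-checking Boolean) and ★★★ its soundness in the `hver` shape
# (27623 `(H) HomFloor (1/625)`, hcp half; critic rows 1108 (3) (iii) / 1110 (2): «entryLeafOKHT (curvCheckLJM(D per box) ∧ farCheck ∧ slopeCheckLJ ∧ σ-cap ∧ fit)
# + _sound»)

decomp-a2c hand-1 g29 (crux `AperiodicFrustratedLawGap`, stmt-AtomisticToContinuum-27623).  On a twelve-coordinate box `(c, w)` (entry box × ξ-cell)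
the leaf CHECKS a driver-computed certificate `p : HTCert` (`…HomEntryLeafHTKit`: matrix shift `D`, near floor `lam₁`, far chunk floors `lam₂`, `lam₃`,
slope constant `Gs`, AM–GM parameters `γS` and confinement radii `rS`) and then runs the existing union verdict `…HomCurvLeafHCC.entryLeafOKHCCX μ` on the
CONFINED box (same entries, ξ-half-widths `htW`): ★ `entryLeafOKHT μ p c w` and ★★★ `entryLeafOKHT_sound` — the `hver` conclusion for every `(U, ξ)` of
the box, by `…HomSlabLeaf.hver_of_slabParts` (outside the slab the centre atom is exempt with NO step parameter — `…HomExemptZeroStep`; inside, the shuffle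
is confined by `…HomSlabConfine.abs_apply_le_of_qcert` + `…HomSlabLeaf.abs_coord_le_of_confined` to the box on which the inner verdict was certified).
At the corner gate cell the sharp radii are `r = (2.75, 3.63, 1.17)·10⁻³` (the AM–GM certificate attains the sharp `max_u |u_k|‖u‖/Q(u)` bound).

Kernel definition + soundness; 0 sorry; standard axioms; no instances / notation / `#eval`.  `--supports stmt-AtomisticToContinuum-27623`.
-/

noncomputable section

namespace Summit.AtomisticToContinuum.Crystallization.Theorems.FrustratedLawDichotomyStrainedPatchHomEntryLeafHT

open scoped BigOperators RealInnerProductSpace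
open Literature.Analysis.ValidatedNumerics.Numerics
open Summit.AtomisticToContinuum.Crystallization.Theorems.ChargedEnergyGapNegative (E3)
open Summit.AtomisticToContinuum.Crystallization.Theorems.FrustratedLawDichotomySchurCut (effPot w₄₅ ω₄)
open Summit.AtomisticToContinuum.Crystallization.Theorems.FrustratedLawDichotomyAveragingRuleTightFree (TightNearCap BadNearCap)
open Summit.AtomisticToContinuum.Crystallization.Theorems.FrustratedLawDichotomyExemptAbsorption (ExemptNear)
open Summit.AtomisticToContinuum.Crystallization.Theorems.FrustratedLawDichotomyStrainedPatchHomSplit (ExRec latPt hexFrame hcpShift)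
open Summit.AtomisticToContinuum.Crystallization.Theorems.FrustratedLawDichotomyStrainedPatchTaylorChord (segGd)
open Summit.AtomisticToContinuum.Crystallization.Theorems.FrustratedLawDichotomyStrainedPatchHomEntryGram (entryFI mem_entryFI)
open Summit.AtomisticToContinuum.Crystallization.Theorems.FrustratedLawDichotomyStrainedPatchHomEntryGramHcp (dot3 shufFI mem_dot3 mem_shufFI)
open Summit.AtomisticToContinuum.Crystallization.Theorems.FrustratedLawDichotomyStrainedPatchHomForceKit (vecB mem_vecB)
open Summit.AtomisticToContinuum.Crystallization.Theorems.FrustratedLawDichotomyStrainedPatchHomHertzKit (hertzTest quadForm_ge_of_hertzTest)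
open Summit.AtomisticToContinuum.Crystallization.Theorems.FrustratedLawDichotomyStrainedPatchHomCurvCentreKit (cenShuf cenShuf_apply)
open Summit.AtomisticToContinuum.Crystallization.Theorems.FrustratedLawDichotomyStrainedPatchHomCurvLeaf
  (nodup_filter_append toFinset_filter_append)
open Summit.AtomisticToContinuum.Crystallization.Theorems.FrustratedLawDichotomyStrainedPatchHomCurvLeafL2 (refW)
open Summit.AtomisticToContinuum.Crystallization.Theorems.FrustratedLawDichotomyStrainedPatchHomCurvLJ (isCenLJ curvCheckLJM)
open Summit.AtomisticToContinuum.Crystallization.Theorems.FrustratedLawDichotomyStrainedPatchHomForceJacN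
  (fjQ fjVec fjE fjX forceJacCheckN boxLabels11 boxLabels11_toFinset boxLabels11_nodup)
open Summit.AtomisticToContinuum.Crystallization.Theorems.FrustratedLawDichotomyStrainedPatchHomSlopeLJ (slopeLJLabelOK slopeCheckLJ forceLJ_ref_bound_of_check)
open Summit.AtomisticToContinuum.Crystallization.Theorems.FrustratedLawDichotomyStrainedPatchHomForceHcp (xiBallOK norm_le_quarter_of_xiBallOK)
open Summit.AtomisticToContinuum.Crystallization.Theorems.FrustratedLawDichotomyStrainedPatchHomCurvLeafHCC (entryLeafOKHCCX entryLeafOKHCCX_sound)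
open Summit.AtomisticToContinuum.Crystallization.Theorems.FrustratedLawDichotomyStrainedPatchHomSlabConfine (abs_apply_le_of_qcert)
open Summit.AtomisticToContinuum.Crystallization.Theorems.FrustratedLawDichotomyStrainedPatchHomSlabLeaf
  (jac_floorM_of_three_checks abs_coord_le_of_confined hver_of_slabParts)

/-! ## §2b. Scaled bounds: slab constant, validated square root, row deviations, confined widths -/

/-- `htW` keeps the entry half-widths. [formal bookkeeping] -/
theorem htW_inl (p : HTCert) (c w : (Fin 3 × Fin 3) ⊕ Fin 3 → ℤ) (ab : Fin 3 × Fin 3) : htW p c w (Sum.inl ab) = w (Sum.inl ab) := rfl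

/-- `htW` on the shuffle coordinates. [formal bookkeeping] -/
theorem htW_inr (p : HTCert) (c w : (Fin 3 × Fin 3) ⊕ Fin 3 → ℤ) (k : Fin 3) :
    htW p c w (Sum.inr k) = p.rS k + cdiv (htκ c w k * 4 * htρ p) (3 * SC) := rfl

/-- ★ The slab constant is dominated by `htT/SC`: `S₇♯(7) + Gs/SC + |R|·6⁻⁷ ≤ htT/SC` (`S₇♯(7) = 8892/7⁷`). [arithmetic] -/
theorem slabConst_le_htT (p : HTCert) (c w : (Fin 3 × Fin 3) ⊕ Fin 3 → ℤ) :
    (6000 / 343 * (7 : ℝ)⁻¹ ^ 4 + 2880 / 49 * (7 : ℝ)⁻¹ ^ 5 + 10 / 7 * (7 : ℝ)⁻¹ ^ 6 + 2 * (7 : ℝ)⁻¹ ^ 7) + (p.Gs : ℝ) / SC +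
      (((htR c w).toFinset.card : ℕ) : ℝ) * (6 : ℝ)⁻¹ ^ 7 ≤ (htT p c w : ℝ) / SC := by
  classical
  have hS : (0 : ℝ) < SC := by norm_num [SC]
  have h7 : (6000 / 343 * (7 : ℝ)⁻¹ ^ 4 + 2880 / 49 * (7 : ℝ)⁻¹ ^ 5 + 10 / 7 * (7 : ℝ)⁻¹ ^ 6 + 2 * (7 : ℝ)⁻¹ ^ 7) = 8892 / 823543 := by
    norm_num
  have h1 : (8892 : ℝ) / 823543 ≤ ((cdiv (8892 * (SC : ℤ)) 823543 : ℤ) : ℝ) / SC := by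
    rw [le_div_iff₀ hS]
    have := div_le_cdiv (a := 8892 * (SC : ℤ)) (b := 823543) (by norm_num)
    push_cast at this
    linarith [show (8892 : ℝ) / 823543 * SC = 8892 * SC / 823543 by ring]
  have h2 : (6 : ℝ)⁻¹ ^ 7 ≤ ((cdiv (SC : ℤ) 279936 : ℤ) : ℝ) / SC := by
    rw [le_div_iff₀ hS]
    have := div_le_cdiv (a := (SC : ℤ)) (b := 279936) (by norm_num)
    have e : (6 : ℝ)⁻¹ ^ 7 * SC = (SC : ℝ) / 279936 := by norm_num; ring
    rw [e]
    push_cast at this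
    exact this
  have hcard : (((htR c w).toFinset.card : ℕ) : ℝ) ≤ ((htR c w).length : ℝ) := by exact_mod_cast List.toFinset_card_le (htR c w)
  have h6 : (0 : ℝ) ≤ 6⁻¹ ^ 7 := by positivity
  have hc0 : (0 : ℝ) ≤ ((cdiv (SC : ℤ) 279936 : ℤ) : ℝ) / SC := h6.trans h2
  rw [h7]
  have e : (htT p c w : ℝ) / SC = ((cdiv (8892 * (SC : ℤ)) 823543 : ℤ) : ℝ) / SC + (p.Gs : ℝ) / SC +
      ((htR c w).length : ℝ) * (((cdiv (SC : ℤ) 279936 : ℤ) : ℝ) / SC) := by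
    simp only [htT, Int.cast_add, Int.cast_mul, Int.cast_natCast]
    ring
  rw [e]
  have h3 : (((htR c w).toFinset.card : ℕ) : ℝ) * (6 : ℝ)⁻¹ ^ 7 ≤ ((htR c w).length : ℝ) * (((cdiv (SC : ℤ) 279936 : ℤ) : ℝ) / SC) :=
    mul_le_mul hcard h2 h6 (Nat.cast_nonneg _)
  linarith

/-- ★ `√(Σ_j (rS_j/SC)²) ≤ htρ/SC`. [folklore: validated square root] -/
theorem sqrt_le_htρ (p : HTCert) : Real.sqrt (∑ j : Fin 3, ((p.rS j : ℝ) / SC) ^ 2) ≤ (htρ p : ℝ) / SC := by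
  have hS : (0 : ℝ) < SC := by norm_num [SC]
  set y : ℝ := ∑ j : Fin 3, ((p.rS j : ℝ) / SC) ^ 2 with hy
  have hy0 : 0 ≤ y := Finset.sum_nonneg fun j _ => sq_nonneg _
  have h1 : y * SC ≤ ((∑ j : Fin 3, p.rS j ^ 2 : ℤ) : ℝ) / SC := by
    have e : y * SC = ((∑ j : Fin 3, p.rS j ^ 2 : ℤ) : ℝ) / SC := by
      rw [hy]; push_cast; rw [Finset.sum_mul, Finset.sum_div]; exact Finset.sum_congr rfl fun j _ => by field_simp
    rw [e]
  have hcd := div_le_cdiv (a := ∑ j : Fin 3, p.rS j ^ 2) (b := (SC : ℤ)) (by exact_mod_cast hS)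
  have hcd' : ((∑ j : Fin 3, p.rS j ^ 2 : ℤ) : ℝ) / SC ≤ ((cdiv (∑ j : Fin 3, p.rS j ^ 2) SC : ℤ) : ℝ) := by exact_mod_cast hcd
  have hmem : FI.mem y ⟨0, cdiv (∑ j : Fin 3, p.rS j ^ 2) SC⟩ := by
    refine ⟨?_, ?_⟩
    · push_cast; positivity
    · exact h1.trans hcd'
  have hs := FI.mem_sqrt hmem
  rw [le_div_iff₀ hS]
  exact hs.2

/-- ★ Row deviations of the entry matrix on the box: `Σ_j |U_kj − δ_kj| ≤ htκ_k/SC`. [folklore] -/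
theorem rowDev_le {c w : (Fin 3 × Fin 3) ⊕ Fin 3 → ℤ} (U : E3 →L[ℝ] E3)
    (hbox : ∀ ab : Fin 3 × Fin 3, |(U (EuclideanSpace.single ab.2 (1 : ℝ))) ab.1 - (c (Sum.inl ab) : ℝ) / SC| ≤ (w (Sum.inl ab) : ℝ) / SC)
    (k : Fin 3) :
    ∑ j : Fin 3, |(U (EuclideanSpace.single j (1 : ℝ))) k - (if k = j then (1 : ℝ) else 0)| ≤ (htκ c w k : ℝ) / SC := by
  have hS : (0 : ℝ) < SC := by norm_num [SC]
  have hj : ∀ j : Fin 3, |(U (EuclideanSpace.single j (1 : ℝ))) k - (if k = j then (1 : ℝ) else 0)| ≤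
      ((|c (Sum.inl (k, j)) - (if k = j then (SC : ℤ) else 0)| + w (Sum.inl (k, j)) : ℤ) : ℝ) / SC := by
    intro j
    have hb := hbox (k, j)
    have htri : |(U (EuclideanSpace.single j (1 : ℝ))) k - (if k = j then (1 : ℝ) else 0)| ≤
        |(U (EuclideanSpace.single j (1 : ℝ))) k - (c (Sum.inl (k, j)) : ℝ) / SC| + |(c (Sum.inl (k, j)) : ℝ) / SC - (if k = j then (1 : ℝ) else 0)| := by
      have := abs_add_le ((U (EuclideanSpace.single j (1 : ℝ))) k - (c (Sum.inl (k, j)) : ℝ) / SC)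
        ((c (Sum.inl (k, j)) : ℝ) / SC - (if k = j then (1 : ℝ) else 0))
      rwa [sub_add_sub_cancel] at this
    have hc : |(c (Sum.inl (k, j)) : ℝ) / SC - (if k = j then (1 : ℝ) else 0)| = ((|c (Sum.inl (k, j)) - (if k = j then (SC : ℤ) else 0)| : ℤ) : ℝ) / SC := by
      rw [Int.cast_abs, ← abs_of_pos hS, ← abs_div, abs_of_pos hS]
      congr 1
      split_ifs
      · push_cast; field_simp
      · push_cast; field_simp; ring
    rw [hc] at htri
    push_cast at htri ⊢
    have : ((w (Sum.inl (k, j)) : ℝ)) / SC + (|((c (Sum.inl (k, j)) : ℝ)) - (if k = j then (SC : ℝ) else 0)|) / SC =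
        (|((c (Sum.inl (k, j)) : ℝ)) - (if k = j then (SC : ℝ) else 0)| + (w (Sum.inl (k, j)) : ℝ)) / SC := by ring
    linarith [hb]
  calc ∑ j : Fin 3, |(U (EuclideanSpace.single j (1 : ℝ))) k - (if k = j then (1 : ℝ) else 0)|
      ≤ ∑ j : Fin 3, ((|c (Sum.inl (k, j)) - (if k = j then (SC : ℤ) else 0)| + w (Sum.inl (k, j)) : ℤ) : ℝ) / SC := Finset.sum_le_sum fun j _ => hj j
    _ = (htκ c w k : ℝ) / SC := by rw [htκ, ← Finset.sum_div]; push_cast; rfl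

/-! ## §3. ★ The leaf and ★★★ its soundness -/

/-- ★ **THE ANALYTIC-SLAB ξ-BOX LEAF**: ball guard ∧ straddlers `≥ 6` ∧ certificate side conditions + three PSD confinement certificates ∧ matrix-shifted
centred curvature certificate on the near labels ∧ sqrt-free far certificates on the two far chunks ∧ slope certificate on the reference box ∧ the union
verdict `entryLeafOKHCCX μ` on the CONFINED box. -/
def entryLeafOKHT (μ : ℤ) (p : HTCert) (c w : (Fin 3 × Fin 3) ⊕ Fin 3 → ℤ) : Bool :=
  xiBallOK c w && htROK c w && htCertOK p c w &&
    curvCheckLJM c w (htCen c w) (htNai c w) p.D p.lam₁ && forceJacCheckN c w (htFar1 c w) p.lam₂ && forceJacCheckN c w (htFar2 c w) p.lam₃ &&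
    slopeCheckLJ c (refW w) (htSc c w) (htSn c w) p.Gs && entryLeafOKHCCX μ c (htW p c w)

/-- ★★★ **SOUNDNESS OF `entryLeafOKHT` IN THE hver SHAPE**: for every `U` of the entry box (self-adjoint, `‖U − 1‖ ≤ 1/4`) and every shuffle `ξ` of the
ξ-cell (wedge signs passed through), the dichotomy `Tight ∨ Exempt ∨ Bad` for every injective enumeration of the homogeneous hcp `133/10`-ball, or the
energy floor `μ/SC` — by the analytic slab: outside the slab about the cell centre `ξ₀` the centre atom is exempt (`…HomExemptZeroStep`), inside it the
shuffle is confined to the box `htW` on which `entryLeafOKHCCX μ` was certified. [folklore chaining: `…HomSlabLeaf.hver_of_slabParts`] -/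
theorem entryLeafOKHT_sound {μ : ℤ} {p : HTCert} {c w : (Fin 3 × Fin 3) ⊕ Fin 3 → ℤ} (h : entryLeafOKHT μ p c w = true) (U : E3 →L[ℝ] E3) (ξ : E3)
    (hsa : ∀ v v' : E3, ⟪U v, v'⟫ = ⟪v, U v'⟫) (hU : ‖U - 1‖ ≤ 1 / 4)
    (hbox : ∀ ab : Fin 3 × Fin 3, |(U (EuclideanSpace.single ab.2 (1 : ℝ))) ab.1 - (c (Sum.inl ab) : ℝ) / SC| ≤ (w (Sum.inl ab) : ℝ) / SC)
    (hξ : ∀ i : Fin 3, |ξ i - (c (Sum.inr i) : ℝ) / SC| ≤ (w (Sum.inr i) : ℝ) / SC) (h0 : 0 ≤ ξ 0) (h2 : 0 ≤ ξ 2) :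
    (∀ (M : ℕ) (z : Fin M → E3) (cc : Fin M), Function.Injective z →
        Set.range z = {x : E3 | dist x (z cc) ≤ 133 / 10 ∧ ∃ a : Fin 3 → ℤ,
          x = z cc + latPt U hexFrame a ∨ x = z cc + latPt U hexFrame a + U (hcpShift + ξ)} →
        TightNearCap (9 / 5) (3 / 2) z cc ∨ ExemptNear (9 / 5) ExRec z cc ∨ BadNearCap (9 / 5) (3 / 2) z cc) ∨
      (μ : ℝ) / SC ≤ ∑ b ∈ (Fintype.piFinset fun _ : Fin 3 => Finset.Icc (-7 : ℤ) 7).filter (fun b => b ≠ 0), effPot w₄₅ ω₄ (3 / 400) ‖latPt U hexFrame b‖ +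
        ∑ b ∈ (Fintype.piFinset fun _ : Fin 3 => Finset.Icc (-7 : ℤ) 7), effPot w₄₅ ω₄ (3 / 400) ‖latPt U hexFrame b + U (hcpShift + ξ)‖ := by
  classical
  have hS : (0 : ℝ) < SC := by norm_num [SC]
  unfold entryLeafOKHT at h
  simp only [Bool.and_eq_true] at h
  obtain ⟨⟨⟨⟨⟨⟨⟨hball, hROK⟩, hcert⟩, hcurvM⟩, hfar1⟩, hfar2⟩, hslope⟩, hinner⟩ := h
  obtain ⟨hT, hγ, hr, hconf⟩ := htCertOK_spec hcert
  -- the reference shuffle: the ξ-centre of the cell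
  set ξ₀ : E3 := cenShuf c with hξ₀def
  have hw0 : ∀ i : Fin 3, (0 : ℝ) ≤ (w (Sum.inr i) : ℝ) / SC := fun i => (abs_nonneg _).trans (hξ i)
  have hξ₀box : ∀ i : Fin 3, |ξ₀ i - (c (Sum.inr i) : ℝ) / SC| ≤ (w (Sum.inr i) : ℝ) / SC := by
    intro i; rw [hξ₀def, cenShuf_apply, sub_self, abs_zero]; exact hw0 i
  have hn : ‖ξ‖ ≤ 1 / 4 := norm_le_quarter_of_xiBallOK hball hξ
  have hn₀ : ‖ξ₀‖ ≤ 1 / 4 := norm_le_quarter_of_xiBallOK hball hξ₀box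
  -- label finsets
  set B : Finset (Fin 3 → ℤ) := (htB c w).toFinset with hBdef
  set R : Finset (Fin 3 → ℤ) := (htR c w).toFinset with hRdef
  have hB : B ⊆ Fintype.piFinset fun _ : Fin 3 => Finset.Icc (-11 : ℤ) 11 := by
    intro b hb
    rw [← boxLabels11_toFinset]
    exact List.mem_toFinset.2 (mem_boxLabels11_of_mem_htB (List.mem_toFinset.1 hb))
  have hBin : ∀ bb ∈ B, ‖latPt U hexFrame bb + U (hcpShift + ξ)‖ ≤ 7 :=
    fun bb hbb => norm_le_seven_of_htIn U hbox ξ hξ (htIn_of_mem_htB (List.mem_toFinset.1 hbb))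
  have hR : ∀ bb ∈ (Fintype.piFinset fun _ : Fin 3 => Finset.Icc (-11 : ℤ) 11) \ B, ‖latPt U hexFrame bb + U (hcpShift + ξ)‖ ≤ 7 →
      bb ∈ R ∧ 6 ≤ ‖latPt U hexFrame bb + U (hcpShift + ξ)‖ := by
    intro bb hbb h7
    obtain ⟨hbox11, hnotB⟩ := Finset.mem_sdiff.1 hbb
    rw [← boxLabels11_toFinset] at hbox11
    have hbL : bb ∈ boxLabels11 := List.mem_toFinset.1 hbox11
    have hlo := lo_le_of_norm_le_seven U hbox ξ hξ h7
    by_cases hin : htIn c w bb = true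
    · exact absurd (List.mem_toFinset.2 (mem_htB_of_htIn hbL hin)) hnotB
    · have hmemR : bb ∈ htR c w := by
        refine List.mem_filter.2 ⟨hbL, ?_⟩
        simp only [Bool.and_eq_true, Bool.not_eq_true', decide_eq_true_eq]
        exact ⟨by simpa using hin, hlo⟩
      have h36 : 36 * (SC : ℤ) ≤ (fjQ c w bb).lo := by
        have := List.all_eq_true.1 hROK bb hmemR
        simpa using this
      exact ⟨List.mem_toFinset.2 hmemR, six_le_norm_of_lo U hbox ξ hξ h36⟩
  -- the Q-floor along the segment
  have hcurv : ∀ s ∈ Set.Ioo (0 : ℝ) 1,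
      ((p.lam₁ + p.lam₂ + p.lam₃ : ℤ) : ℝ) / SC * ‖U (ξ - ξ₀)‖ ^ 2 + ∑ i : Fin 3, ∑ j : Fin 3, (p.D i j : ℝ) / SC * ((U (ξ - ξ₀)) i * (U (ξ - ξ₀)) j) ≤
        ∑ bb ∈ B, segGd (fun x : ℝ => x⁻¹ ^ 7 - x⁻¹ ^ 13) (latPt U hexFrame bb + U (hcpShift + ξ₀)) (U (ξ - ξ₀)) s :=
    fun s hs => jac_floorM_of_three_checks (htB_nodup c w) hcurvM hfar1 hfar2 U hU hbox ξ₀ ξ hξ₀box hξ hn₀ hn hs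
  -- the reference force bound
  have hf₀ : |∑ bb ∈ B, (‖latPt U hexFrame bb + U (hcpShift + ξ₀)‖⁻¹ ^ 8 - ‖latPt U hexFrame bb + U (hcpShift + ξ₀)‖⁻¹ ^ 14) *
      ⟪latPt U hexFrame bb + U (hcpShift + ξ₀), U (ξ - ξ₀)⟫| ≤ (p.Gs : ℝ) / SC * ‖U (ξ - ξ₀)‖ := by
    have hbox' : ∀ ab : Fin 3 × Fin 3, |(U (EuclideanSpace.single ab.2 (1 : ℝ))) ab.1 - (c (Sum.inl ab) : ℝ) / SC| ≤ (refW w (Sum.inl ab) : ℝ) / SC :=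
      fun ab => by rw [refW_inl]; exact hbox ab
    have hξ₀' : ∀ i : Fin 3, |ξ₀ i - (c (Sum.inr i) : ℝ) / SC| ≤ (refW w (Sum.inr i) : ℝ) / SC := by
      intro i; rw [refW_inr, hξ₀def, cenShuf_apply, sub_self, abs_zero]; simp
    have key := forceLJ_ref_bound_of_check (nodup_filter_append (htB_nodup c w) fun b => slopeLJLabelOK c (refW w) b) hslope U hU hbox' ξ₀ hξ₀' hn₀ ξ
    rw [toFinset_filter_append] at key
    exact key
  -- slab ⟹ confinement ⟹ the inner verdict on the confined box
  have hslab : ((p.lam₁ + p.lam₂ + p.lam₃ : ℤ) : ℝ) / SC * ‖U (ξ - ξ₀)‖ ^ 2 +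
        ∑ i : Fin 3, ∑ j : Fin 3, (p.D i j : ℝ) / SC * ((U (ξ - ξ₀)) i * (U (ξ - ξ₀)) j) ≤
      ((6000 / 343 * (7 : ℝ)⁻¹ ^ 4 + 2880 / 49 * (7 : ℝ)⁻¹ ^ 5 + 10 / 7 * (7 : ℝ)⁻¹ ^ 6 + 2 * (7 : ℝ)⁻¹ ^ 7) + (p.Gs : ℝ) / SC +
        R.card * (6 : ℝ)⁻¹ ^ 7) * ‖U (ξ - ξ₀)‖ →
      (∀ (M : ℕ) (z : Fin M → E3) (cc : Fin M), Function.Injective z →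
          Set.range z = {x : E3 | dist x (z cc) ≤ 133 / 10 ∧ ∃ a : Fin 3 → ℤ,
            x = z cc + latPt U hexFrame a ∨ x = z cc + latPt U hexFrame a + U (hcpShift + ξ)} →
          TightNearCap (9 / 5) (3 / 2) z cc ∨ ExemptNear (9 / 5) ExRec z cc ∨ BadNearCap (9 / 5) (3 / 2) z cc) ∨
        (μ : ℝ) / SC ≤ ∑ b ∈ (Fintype.piFinset fun _ : Fin 3 => Finset.Icc (-7 : ℤ) 7).filter (fun b => b ≠ 0), effPot w₄₅ ω₄ (3 / 400) ‖latPt U hexFrame b‖ +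
          ∑ b ∈ (Fintype.piFinset fun _ : Fin 3 => Finset.Icc (-7 : ℤ) 7), effPot w₄₅ ω₄ (3 / 400) ‖latPt U hexFrame b + U (hcpShift + ξ)‖ := by
    intro hq
    have ht0 : (0 : ℝ) < (htT p c w : ℝ) / SC := div_pos (by exact_mod_cast hT) hS
    have hle := slabConst_le_htT p c w
    have hQ : (p.lamT : ℝ) / SC * ‖U (ξ - ξ₀)‖ ^ 2 + ∑ i : Fin 3, ∑ j : Fin 3, (p.D i j : ℝ) / SC * ((U (ξ - ξ₀)) i * (U (ξ - ξ₀)) j) ≤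
        (htT p c w : ℝ) / SC * ‖U (ξ - ξ₀)‖ := by
      have e : (p.lamT : ℝ) = ((p.lam₁ + p.lam₂ + p.lam₃ : ℤ) : ℝ) := by simp [HTCert.lamT]
      rw [e]
      exact hq.trans (mul_le_mul_of_nonneg_right hle (norm_nonneg _))
    have hΔk : ∀ k : Fin 3, |(U (ξ - ξ₀)) k| ≤ (p.rS k : ℝ) / SC := fun k =>
      abs_apply_le_of_qcert (Q := fun x : E3 => (p.lamT : ℝ) / SC * ‖x‖ ^ 2 + ∑ i : Fin 3, ∑ j : Fin 3, (p.D i j : ℝ) / SC * (x i * x j))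
        ht0 (div_pos (by exact_mod_cast hγ k) hS) (div_nonneg (by exact_mod_cast hr k) hS.le) k (fun x => htConf_sound (hconf k) x) hQ
    have hy := fun k => abs_coord_le_of_confined hU (ξ - ξ₀) (r := fun j => (p.rS j : ℝ) / SC) (κ := fun k => (htκ c w k : ℝ) / SC) hΔk
      (rowDev_le U hbox) k
    -- the confined box
    have hξ' : ∀ i : Fin 3, |ξ i - (c (Sum.inr i) : ℝ) / SC| ≤ (htW p c w (Sum.inr i) : ℝ) / SC := by
      intro i
      have hyi := hy i
      have e1 : (ξ - ξ₀) i = ξ i - (c (Sum.inr i) : ℝ) / SC := by rw [PiLp.sub_apply, hξ₀def, cenShuf_apply]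
      rw [e1] at hyi
      refine hyi.trans ?_
      rw [htW_inr]
      have hρ := sqrt_le_htρ p
      have hκ0 : (0 : ℝ) ≤ (htκ c w i : ℝ) / SC :=
        (Finset.sum_nonneg fun j _ => abs_nonneg _).trans (rowDev_le U hbox i)
      have hρ0 : (0 : ℝ) ≤ (htρ p : ℝ) := by
        have := (Real.sqrt_nonneg _).trans hρ
        rw [le_div_iff₀ hS, zero_mul] at this; exact this
      have hcd := div_le_cdiv (a := htκ c w i * 4 * htρ p) (b := 3 * (SC : ℤ)) (by norm_num [SC])
      have step : (htκ c w i : ℝ) / SC * (4 / 3 * Real.sqrt (∑ j : Fin 3, ((p.rS j : ℝ) / SC) ^ 2)) ≤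
          ((cdiv (htκ c w i * 4 * htρ p) (3 * SC) : ℤ) : ℝ) / SC := by
        have h1 : (htκ c w i : ℝ) / SC * (4 / 3 * Real.sqrt (∑ j : Fin 3, ((p.rS j : ℝ) / SC) ^ 2)) ≤
            (htκ c w i : ℝ) / SC * (4 / 3 * ((htρ p : ℝ) / SC)) := by gcongr
        refine h1.trans ?_
        rw [le_div_iff₀ hS]
        have e : (htκ c w i : ℝ) / SC * (4 / 3 * ((htρ p : ℝ) / SC)) * SC = ((htκ c w i * 4 * htρ p : ℤ) : ℝ) / ((3 * (SC : ℤ) : ℤ) : ℝ) := by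
          push_cast; field_simp
        rw [e]; exact hcd
      push_cast
      rw [add_div]
      linarith
    have hbox'' : ∀ ab : Fin 3 × Fin 3, |(U (EuclideanSpace.single ab.2 (1 : ℝ))) ab.1 - (c (Sum.inl ab) : ℝ) / SC| ≤ (htW p c w (Sum.inl ab) : ℝ) / SC :=
      fun ab => by rw [htW_inl]; exact hbox ab
    exact entryLeafOKHCCX_sound hinner U ξ hsa hU hbox'' hξ' h0 h2
  exact hver_of_slabParts hU hn₀ hn B R hB hBin hR hcurv hf₀ hslab

end Summit.AtomisticToContinuum.Crystallization.Theorems.FrustratedLawDichotomyStrainedPatchHomEntryLeafHT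

end
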